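/-
Copyright (c) 2026 the pub-hodgecm-mathlib formalisation cell (harness21).  Prover seat hodgecm-mathlib-LH4-p02 (g11): line LH4, road «2V⁺» (LH4-plan (g8)
PRICE-MEMO-DUNR-2V v2 + census `CENSUS-O2-typeTwoVertexRow.v1.LH4p02g11` 0ea3ed94 §2, WORD #15 (Q5)), organ (O1⁺) ‹RANK-2V⁺› = ★ p852521 (LH7-p01 (g9))
`exists_twoVertexPieces_det_classOrbitalIntegral_ne_zero` by paste with the fourth piece re-tokened; 2026-09-02.
-/
import Literature.NumberTheory.Rogawski1990.UnipotentLevelPiecesFrameCM                  -- ★ FILE 2a: the frame `ψ = T·e(·)·T⁻¹`, `K_std` ∕ classes through `ψ`; brings ★ `UnitaryVertexStabilizerCoverCM`, ★ `UnitaryLatticeTreeFrameChange`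
import Literature.NumberTheory.Automorphic.OrbitalIntegralIndicatorSeparation          -- ★ p846366 the abstract RANK head `det_classOrbitalIntegral_indicator_ne_zero`
import Literature.NumberTheory.LocalFields.UnramifiedQuadraticNormAtInertPlaceValued   -- ★ units of `L⁺_v` are norms ∕ a `σ_w`-skew unit, in `Valued.v` currency
import Literature.NumberTheory.Automorphic.FiniteAdeleFactorizable                     -- ★ `isClopen_setOf_valued_le`
import Literature.NumberTheory.Automorphic.UnitaryLatticeTreeApartment                 -- ★ T1 `isVertexLattice_two_latt_diagonal_zpow` (the apartment vertices `t_a · N₁` are of type `2`)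
import Literature.NumberTheory.Automorphic.UnitaryLatticeTreeLevelShift                -- ★ T1 (kept for its transitive imports)
import Literature.NumberTheory.Automorphic.UnitaryLatticeTreeDual                      -- ★ T1 `dualLatt_latt`, `latt_le_latt_iff`, `latt_mul` (the dual-lattice token in a basis)
import HarnessLib

/-!
# ‹RANK-2V⁺›: ★ ‹RANK-2V› (p852521) with the type-two-vertex piece re-tokened `1_{K_g ∖ K_g⁺}`, `K_g⁺ = {(e y − 1)·(latt g)^♯ ≤ latt g}` («fixes every self-dual neighbour»)
Topic `NumberTheory/Rogawski1990`.  THEOREMS ONLY (no definition ∕ instance ∕ notation ∕ named fact ∕ `sorry`); lane `--supports stmt-HodgeConjecture-24833`, count-neutral.  Cell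
`pub/hodgecm-mathlib` (D-0151), crux H413, line LH4 (`stub_N6ns`), dyadic unramified organ (D-UNR) (PRINT, D74′); road «2V» (LH4-plan (g8) `PRICE-MEMO-DUNR-2V` v1, LEAD T14-24 (B)),
organ (O1⁺), DEAL g8-#2 (WORD #18; LEAD T14-46 (Q5)).  MOY–PRASAD TOKEN: `K_g⁺` = the kernel of `K_g → U((latt g)^♯ ∕ latt g)(𝓀)` («`y` fixes every self-dual neighbour of
`latt g`»), chosen so that the type-two-vertex transfer rows are COROLLARIES of the hyperspecial rows (census `CENSUS-O2-typeTwoVertexRow.v1.LH4p02g11` 0ea3ed94 §1–§2: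
`Φ(⟦δ⟧, 1_{K_g}) = ν(K_g)(q³n₀(δ) + 1)`, `Φ(⟦δ⟧, 1_{K_g⁺}) = ν(K_g)(n(δ) − 1)∕q` for deep `δ` by the elliptic Euler–Poincaré relation on the `U(3)_v` tree), whereas ★'s token
`K_g(1) = {(e y − 1)·latt g ≤ ϖ·latt g}` would need a new second-layer count.  VERBATIM SIBLING of ★
(O1) `UnipotentOrbitalIntegralTwoVertexPiecesCM` and of ★ RANK′ `UnipotentOrbitalIntegralLevelPiecesUnramifiedAllCM` (same frame `ψ = T·e·T⁻¹`, classification and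
abstract head ★ `det_classOrbitalIntegral_indicator_ne_zero`), with ★'s LEVEL-TWO pieces `1_{K(2)}`, `1_{K(1)∖K(2)}` replaced by DEPTH-ZERO pieces at the two vertex types: the fourth
functional on the unipotent classes `1, tv⁻ = [n(ϖδ)], tv⁺ = [n(δ)], reg` is read at the TYPE-TWO vertex `latt (T⁻¹·diag(ϖ,1,1))` (`= 𝔪e₁ ⊕ 𝒪e₂ ⊕ 𝒪e₃` in the frame) adjacent to the
hyperspecial one, stabiliser `K′ = {D⁻¹ψD ∈ GL₃(𝒪)}`, `D = diag(ϖ,1,1)`; the piece is `K′` MINUS `K′⁺ = {(ψ − 1)·Λ^♯ ⊆ Λ}` (`Λ = 𝔪e₁⊕𝒪e₂⊕𝒪e₃`, `Λ^♯ = 𝒪e₁⊕𝒪e₂⊕𝔪⁻¹e₃`).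
THE TABLE (rows `1, tv⁻, tv⁺, reg`; columns `1_{K(1)}, 1_{K′∖K′⁺}, 1_{K∖K(1)}, 1_R`, `R = {(ψy − 1)² ≢ 0 (𝔪_w)}`) is lower triangular with non-zero diagonal: `1 ∈ K(1)`; `D⁻¹ n(ϖδ) D = n(δ)`
is integral, so `n(ϖδ) ∈ K′`, and `(n(ϖδ) − 1)(ϖ⁻¹e₃) = δe₁ ∉ Λ` (`δ` a unit), so `n(ϖδ) ∉ K′⁺` — in Gram currency: `X := g⁻¹(e x − 1)g·G_g⁻¹` integral would give `δ = X₀₀·ϖ`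
(`G_g = formCongr σ (T g) J₀ = D J₀ D`, third column `(ϖ, 0, 0)`), contradicting `|δ| = 1`; while `1 ∈ K′⁺`; `n(δ) ∈ K ∖ K(1)` and (★ PARITY ROW) every integral conjugate of `n(ϖδ)` is `≡ 1 (𝔪_w)`; `u(1,−t₀) ∈ R` and the
square-zero classes miss `R` (★ RANK′ §4 verbatim).  FRAME-FREE statement: the type-two vertex is `∃`-quantified as `latt g` (`IsVertexLattice … 2`), its stabiliser is the ★
`mapGL (e u) (latt g) = latt g` test, its radical the dual-lattice token `(e u − 1)·(dualLatt σ_w H_w (latt g)) ⊆ latt g` (★ `dualLatt`, read in a basis by ★ `dualLatt_latt` +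
★ `latt_le_latt_iff`); the `K`-strata are ★ RANK′'s valuation tokens on `e u − 1`.  The four
pieces are NAMED in the conclusion (explicit-pieces clause) instead of ★'s `tsupport ⊆ K` ∕ `Ad K` ∕ left-`K(2)` conjuncts (the new piece lives at `K′ ⊄ K`).
HONEST LABEL: count-neutral; HC_CM is proved only modulo the 7 printed citations (2 remaining named inputs: hLiu418 = stmt-HodgeConjecture-24832, h413 = stmt-HodgeConjecture-24833)
until rung 0 closes; nothing printed is asserted here ((D-UNR) stays PRINT; this is a Literature theorem for the 2V road).
* **`exists_twoVertexPiecesPlus_det_classOrbitalIntegral_ne_zero`** — the head.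
## References
* [Rogawski1990] J. D. Rogawski, *Automorphic Representations of Unitary Groups in Three Variables*, Ann. of Math. Stud. 123 (1990), §8.1 pp. 112–114; §3.9 Prop. 3.9.1 p. 32; §4.9 p. 54.
* [BruhatTits1972] F. Bruhat, J. Tits, *Groupes réductifs sur un corps local I*, Publ. Math. IHÉS 41 (1972), §10 (the two vertex types of the `U(3)` tree).
* [HarishChandra1999AdmissibleDistributions] Harish-Chandra, *Admissible Invariant Distributions on Reductive p-adic Groups*, AMS ULS 16 (1999), §3.1 p. 17.
-/

set_option autoImplicit false
noncomputable section
open scoped WithZero Matrix MatrixGroups ValuativeRel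
open Topology Set NumberField IsDedekindDomain Matrix MeasureTheory

namespace Literature.NumberTheory.Rogawski1990

open Literature.NumberTheory.Automorphic Literature.NumberTheory.Automorphic.UnitaryGroup Literature.NumberTheory.GaloisRepresentations
open Literature.NumberTheory.Automorphic.UnitaryLatticeTree Literature.NumberTheory.Automorphic.HermitianLattice Literature.MeasureTheory.Group
open Literature.NumberTheory.LocalFields.UnramifiedQuadraticNorm

set_option maxHeartbeats 1600000 in
open scoped Classical in
/-- **‹RANK-2V⁺› — the two-vertex unipotent table at an UNRAMIFIED non-split place, any residue characteristic, radical token.**  At a non-split place `v` unramified in `L` with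
`H′_w ∈ GL₃(𝒪_w)`, for every finite set `S` of UNIPOTENT classes of `U(H′)(L⁺_v)` and every orbital-measure family `mU` admissible on `S` with the Rao clause, there are a
uniformiser `ϖ` of `L_w`, a TYPE-TWO vertex `latt g` of the lattice tree of `(L_w³, H′_w)` and reference pieces `g_u ∈ C_c^∞` (`u ∈ S`), each one of the four NAMED indicators
`1_{K(1)}` (hyperspecial first congruence set), `1_{K_g ∖ K_g⁺}` (the stabiliser of `latt g` minus its radical, `e u · latt g = latt g ∧ ¬ (e u − 1)·(latt g)^♯ ⊆ latt g`,
`(latt g)^♯ = dualLatt σ_w (placeForm H′ w) (latt g)`),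
`1_{K ∖ K(1)}`, `1_R` (`R = {y ∈ K | (e y − 1)² ≢ 0 (𝔪_w)}`), with `det (Φ_{mU}(u, g_{u′}))_{u,u′ ∈ S} ≠ 0`.  (`e = localNonsplitEquiv`; `K = U(H′)(𝒪_v)`.)
ANY residue characteristic (no `h2`, as ★ RANK′): the skew unit `δ`, the trace-one integer and the unit-norm surjectivity exist for every unramified quadratic `L_w ∕ L⁺_v`; the only `2`
used is `(2 : L_w) ≠ 0` (characteristic `0`, ★ `exists_conj_eq_of_regular_unipotent`).  Road «2V⁺»: LH4-plan (g8) memo v2 279215577d5096c2 + WORD #15; census 0ea3ed94 §2.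
[cite: Rogawski1990, §8.1 Prop. 8.1.2 p. 114; §3.9 Prop. 3.9.1 p. 32; §4.9 p. 54] [cite: BruhatTits1972, §10] [cite: HarishChandra1999AdmissibleDistributions, §3.1 p. 17] -/
theorem exists_twoVertexPiecesPlus_det_classOrbitalIntegral_ne_zero
    (L : Type) [Field L] [NumberField L] [IsCMField L] (H' : Matrix (Fin 3) (Fin 3) L)
    {v : HeightOneSpectrum (𝓞 ↥(maximalRealSubfield L))}
    (hH' : (H'.map (cmConjRingHom L)).transpose = H') (w : PlacesOver L v)
    (hw : IsCMField.complexConj L • w.1 = w.1) (hv : Algebra.IsUnramifiedIn (𝓞 L) v.asIdeal)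
    (hH'w : IsUnit (placeForm H' w.1)) (hH'i : hH'w.unit ∈ glInt 3 (w.1.adicCompletion L))
    [MeasurableSpace ((cmDatum L 3 H').Local v)] [BorelSpace ((cmDatum L 3 H').Local v)]
    [∀ γ : ((cmDatum L 3 H').Local v), MeasurableSpace (((cmDatum L 3 H').Local v) ⧸ Subgroup.centralizer ({γ} : Set ((cmDatum L 3 H').Local v)))]
    [∀ γ : ((cmDatum L 3 H').Local v), BorelSpace (((cmDatum L 3 H').Local v) ⧸ Subgroup.centralizer ({γ} : Set ((cmDatum L 3 H').Local v)))]
    (S : Finset (ConjClasses ((cmDatum L 3 H').Local v)))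
    (hS : ∀ u ∈ S, (((Quotient.out u : (cmDatum L 3 H').Local v).val : GL (Fin 3) (UnitaryGroup.LocalRing L v)).val - 1) ^ 3 = 0)
    (mU : OrbitalMeasureFamily ((cmDatum L 3 H').Local v)) (hmU : mU.IsAdmissibleOn (fun γ => (ConjClasses.mk γ) ∈ S))
    (hRao : ∀ u ∈ S, ∀ f : (cmDatum L 3 H').Local v → ℂ, IsLocSmooth f →
      Integrable (descConj (Quotient.out u : (cmDatum L 3 H').Local v)
        (Subgroup.centralizer ({(Quotient.out u : (cmDatum L 3 H').Local v)} : Set ((cmDatum L 3 H').Local v)))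
        (fun _ hg => Subgroup.mem_centralizer_singleton_iff.1 hg) f) (mU u)) :
    ∃ (ϖ : w.1.adicCompletion L) (g : GL (Fin 3) (w.1.adicCompletion L)),
      Valued.v ϖ = WithZero.exp (-1 : ℤ) ∧
      IsVertexLattice (galAdicCompletionMap (L := L) (IsCMField.complexConj L) hw) ϖ (placeForm H' w.1) 2
        (latt (g : Matrix (Fin 3) (Fin 3) (w.1.adicCompletion L))) ∧
      ∃ gref : ↥S → ((cmDatum L 3 H').Local v) → ℂ,
        (∀ i, IsLocSmooth (gref i)) ∧
        (∀ i,
          gref i = Set.indicator {y | y ∈ cmLocalIntegralLevel L 3 H' v ∧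
              ∀ a b, Valued.v (((((localNonsplitEquiv (IsCMField.complexConj L) H' (IsCMField.complexConj_ne_one L) w hw y :
                ↥(unitaryGroupOfForm (galAdicCompletionMap (L := L) (IsCMField.complexConj L) hw) (placeForm H' w.1))) : GL (Fin 3) (w.1.adicCompletion L)) :
                  Matrix (Fin 3) (Fin 3) (w.1.adicCompletion L)) - 1) a b) ≤ WithZero.exp (-1 : ℤ)} (fun _ => (1 : ℂ)) ∨
          gref i = Set.indicator {y : (cmDatum L 3 H').Local v |
              mapGL ((localNonsplitEquiv (IsCMField.complexConj L) H' (IsCMField.complexConj_ne_one L) w hw y :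
                ↥(unitaryGroupOfForm (galAdicCompletionMap (L := L) (IsCMField.complexConj L) hw) (placeForm H' w.1))) : GL (Fin 3) (w.1.adicCompletion L))
                (latt (g : Matrix (Fin 3) (Fin 3) (w.1.adicCompletion L))) = latt (g : Matrix (Fin 3) (Fin 3) (w.1.adicCompletion L)) ∧
              ¬ (dualLatt (galAdicCompletionMap (L := L) (IsCMField.complexConj L) hw) (placeForm H' w.1)
                  (latt (g : Matrix (Fin 3) (Fin 3) (w.1.adicCompletion L)))).map ((Matrix.toLin'
                  ((((localNonsplitEquiv (IsCMField.complexConj L) H' (IsCMField.complexConj_ne_one L) w hw y :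
                    ↥(unitaryGroupOfForm (galAdicCompletionMap (L := L) (IsCMField.complexConj L) hw) (placeForm H' w.1))) : GL (Fin 3) (w.1.adicCompletion L)) :
                      Matrix (Fin 3) (Fin 3) (w.1.adicCompletion L)) - 1)).restrictScalars (Valued.integer (w.1.adicCompletion L))) ≤
                latt (g : Matrix (Fin 3) (Fin 3) (w.1.adicCompletion L))} (fun _ => (1 : ℂ)) ∨
          gref i = Set.indicator {y | y ∈ cmLocalIntegralLevel L 3 H' v ∧
              ¬ ∀ a b, Valued.v (((((localNonsplitEquiv (IsCMField.complexConj L) H' (IsCMField.complexConj_ne_one L) w hw y :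
                ↥(unitaryGroupOfForm (galAdicCompletionMap (L := L) (IsCMField.complexConj L) hw) (placeForm H' w.1))) : GL (Fin 3) (w.1.adicCompletion L)) :
                  Matrix (Fin 3) (Fin 3) (w.1.adicCompletion L)) - 1) a b) ≤ WithZero.exp (-1 : ℤ)} (fun _ => (1 : ℂ)) ∨
          gref i = Set.indicator {y | y ∈ cmLocalIntegralLevel L 3 H' v ∧
              ¬ ∀ a b, Valued.v ((((((localNonsplitEquiv (IsCMField.complexConj L) H' (IsCMField.complexConj_ne_one L) w hw y :
                ↥(unitaryGroupOfForm (galAdicCompletionMap (L := L) (IsCMField.complexConj L) hw) (placeForm H' w.1))) : GL (Fin 3) (w.1.adicCompletion L)) :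
                  Matrix (Fin 3) (Fin 3) (w.1.adicCompletion L)) - 1) *
                ((((localNonsplitEquiv (IsCMField.complexConj L) H' (IsCMField.complexConj_ne_one L) w hw y :
                ↥(unitaryGroupOfForm (galAdicCompletionMap (L := L) (IsCMField.complexConj L) hw) (placeForm H' w.1))) : GL (Fin 3) (w.1.adicCompletion L)) :
                  Matrix (Fin 3) (Fin 3) (w.1.adicCompletion L)) - 1)) a b) ≤ WithZero.exp (-1 : ℤ)} (fun _ => (1 : ℂ))) ∧
        (Matrix.of fun u u' : ↥S => classOrbitalIntegral mU (gref u') u).det ≠ 0 := by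
  classical
  -- ## 0. The frame `ψ = T·e(·)·T⁻¹ : G′_v → U(σ_w, J₀)(L_w)` (★ FILE 2a) and the unramified datum at `w`
  obtain ⟨T, hTint, hT⟩ := exists_glInt_placeForm_eq_formCongr_antidiagonal_of_isUnramifiedIn (↥(maximalRealSubfield L)) L (IsCMField.complexConj L)
    (IsCMField.complexConj_ne_one L) 3 H' hH' v w hw hv hH'w hH'i
  obtain ⟨ψ, hψ⟩ : ∃ ψ : (cmDatum L 3 H').Local v → GL (Fin 3) (w.1.adicCompletion L), ∀ y, ψ y =
      T * ((localNonsplitEquiv (IsCMField.complexConj L) H' (IsCMField.complexConj_ne_one L) w hw y :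
        ↥(unitaryGroupOfForm (galAdicCompletionMap (L := L) (IsCMField.complexConj L) hw) (placeForm H' w.1))) : GL (Fin 3) (w.1.adicCompletion L)) * T⁻¹ :=
    ⟨_, fun _ => rfl⟩
  have hψU : ∀ y, ψ y ∈ unitaryGroupOfForm (galAdicCompletionMap (L := L) (IsCMField.complexConj L) hw) ((StdForm.antidiagonal 3).over (w.1.adicCompletion L)) :=
    fun y => by rw [hψ]; exact conj_localNonsplitEquiv_mem L H' v w hw hT y
  have hψsurj : ∀ g ∈ unitaryGroupOfForm (galAdicCompletionMap (L := L) (IsCMField.complexConj L) hw) ((StdForm.antidiagonal 3).over (w.1.adicCompletion L)),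
      ∃ y, ψ y = g := fun g hg => by simp only [hψ]; exact exists_conj_localNonsplitEquiv_eq L H' v w hw hT hg
  have hψK : ∀ y, y ∈ cmLocalIntegralLevel L 3 H' v ↔ IsIntMatrix ((ψ y : GL (Fin 3) (w.1.adicCompletion L)) : Matrix (Fin 3) (Fin 3) (w.1.adicCompletion L)) :=
    fun y => by rw [hψ]; exact mem_cmLocalIntegralLevel_iff_isIntMatrix_conj L H' v w hw hT hTint y
  have hψconj : ∀ y y', ConjClasses.mk y = ConjClasses.mk y' ↔
      ∃ k : GL (Fin 3) (w.1.adicCompletion L), k ∈ unitaryGroupOfForm (galAdicCompletionMap (L := L) (IsCMField.complexConj L) hw)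
        ((StdForm.antidiagonal 3).over (w.1.adicCompletion L)) ∧ k * ψ y * k⁻¹ = ψ y' :=
    fun y y' => by simp only [hψ]; exact conjClasses_mk_eq_iff_exists_conj L H' v w hw hT y y'
  have hψcont : ∀ a b, Continuous fun y => ((ψ y : GL (Fin 3) (w.1.adicCompletion L)) : Matrix (Fin 3) (Fin 3) (w.1.adicCompletion L)) a b := fun a b => by
    simp only [hψ]; exact continuous_conj_localNonsplitEquiv_apply L H' v w hw a b
  have hψnil : ∀ u ∈ S, (((ψ (Quotient.out u) : GL (Fin 3) (w.1.adicCompletion L)) : Matrix (Fin 3) (Fin 3) (w.1.adicCompletion L)) - 1) ^ 3 = 0 :=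
    fun u hu => by rw [hψ]; exact conj_localNonsplitEquiv_sub_one_pow_eq_zero L H' v w hw (hS u hu)
  have hout : ∀ c : ConjClasses ((cmDatum L 3 H').Local v), ConjClasses.mk (Quotient.out c) = c := fun c => by rw [← ConjClasses.quotient_mk_eq_mk, Quotient.out_eq]
  obtain ⟨ϖ, hd⟩ := unramifiedLocalConjDatum_adicCompletion (IsCMField.complexConj L) (IsCMField.complexConj_ne_one L) v w hw hv
  have hcc : IsCMField.complexConj L * IsCMField.complexConj L = 1 := AlgEquiv.ext fun y => IsCMField.complexConj_apply_apply L y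
  have hnormU : ∀ x : w.1.adicCompletion L, galAdicCompletionMap (L := L) (IsCMField.complexConj L) hw x = x → Valued.v x = 1 →
      ∃ z : w.1.adicCompletion L, z * galAdicCompletionMap (L := L) (IsCMField.complexConj L) hw z = x := fun x hσx hvx =>
    exists_mul_galAdicCompletionMap_eq_of_valued_eq_one (IsCMField.complexConj L) v (IsCMField.complexConj_ne_one L) hcc hv w hw hσx hvx
  obtain ⟨δ, hσδ, hvδ⟩ := exists_galAdicCompletionMap_eq_neg_valued_eq_one (IsCMField.complexConj L) v (IsCMField.complexConj_ne_one L) hcc hv w hw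
  obtain ⟨t₀, ht₀, htr⟩ := hd.trace
  haveI : CharZero (w.1.adicCompletion L) := charZero_of_injective_algebraMap (algebraMap L _).injective
  have h2K : (2 : w.1.adicCompletion L) ≠ 0 := two_ne_zero
  obtain ⟨n₀, hn₀⟩ := exists_units_coe_eq_cornerUnipotent' δ
  obtain ⟨n₁, hn₁, hn₁inv⟩ := exists_units_coe_eq_cornerUnipotent (ϖ * δ)
  obtain ⟨ur, hur, -⟩ := exists_units_coe_eq_upperTriangularUnipotent (1 : w.1.adicCompletion L) (-t₀) (-1)
  obtain ⟨IsCj, hIsCj⟩ : ∃ IsCj : GL (Fin 3) (w.1.adicCompletion L) → GL (Fin 3) (w.1.adicCompletion L) → Prop, ∀ g n, IsCj g n ↔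
      ∃ k : GL (Fin 3) (w.1.adicCompletion L), k ∈ unitaryGroupOfForm (galAdicCompletionMap (L := L) (IsCMField.complexConj L) hw) ((StdForm.antidiagonal 3).over (w.1.adicCompletion L)) ∧ k * g * k⁻¹ = n := ⟨_, fun _ _ => Iff.rfl⟩
  have hσ1 : galAdicCompletionMap (L := L) (IsCMField.complexConj L) hw (ϖ * δ) = -(ϖ * δ) := by rw [map_mul, hd.σϖ, hσδ, mul_neg]
  have hv1 : Valued.v (ϖ * δ) = WithZero.exp (-1 : ℤ) := by rw [map_mul, hd.vϖ, hvδ, mul_one]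
  have hn₀U : n₀ ∈ unitaryGroupOfForm (galAdicCompletionMap (L := L) (IsCMField.complexConj L) hw) ((StdForm.antidiagonal 3).over (w.1.adicCompletion L)) :=
    (mem_unitaryGroupOfForm_iff_of_coe_eq_cornerUnipotent _ hn₀).2 (by rw [hσδ, neg_add_cancel])
  have hn₁U : n₁ ∈ unitaryGroupOfForm (galAdicCompletionMap (L := L) (IsCMField.complexConj L) hw) ((StdForm.antidiagonal 3).over (w.1.adicCompletion L)) :=
    (mem_unitaryGroupOfForm_iff_of_coe_eq_cornerUnipotent _ hn₁).2 (by rw [hσ1, neg_add_cancel])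
  obtain ⟨hurU, hurint, -, hurreg, hurnil⟩ := upperUnipotentOne_facts (galAdicCompletionMap (L := L) (IsCMField.complexConj L) hw) hd.σσ ht₀ htr hur
  have hexp1lt : WithZero.exp (-1 : ℤ) < (1 : ℤᵐ⁰) := by rw [← WithZero.exp_zero]; exact WithZero.exp_lt_exp.2 (by norm_num)
  -- ## 0b. The TYPE-TWO VERTEX next to the hyperspecial one: `e`, `D = diag(ϖ,1,1)`, `g = T⁻¹·D` (so `g⁻¹·e(y)·g = D⁻¹·ψ(y)·D` and `latt g ↔ 𝔪e₁ ⊕ 𝒪e₂ ⊕ 𝒪e₃` in the frame)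
  obtain ⟨E, hE⟩ : ∃ E : (cmDatum L 3 H').Local v → GL (Fin 3) (w.1.adicCompletion L), ∀ y, E y =
      ((localNonsplitEquiv (IsCMField.complexConj L) H' (IsCMField.complexConj_ne_one L) w hw y :
        ↥(unitaryGroupOfForm (galAdicCompletionMap (L := L) (IsCMField.complexConj L) hw) (placeForm H' w.1))) : GL (Fin 3) (w.1.adicCompletion L)) :=
    ⟨_, fun _ => rfl⟩
  have hψE : ∀ y, ψ y = T * E y * T⁻¹ := fun y => by rw [hψ, hE]
  have hϖ0 : ϖ ≠ 0 := fun h => by have h' := hd.vϖ; rw [h, map_zero] at h'; exact WithZero.exp_ne_zero h'.symm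
  have hϖ1 : Valued.v ϖ ≤ 1 := by rw [hd.vϖ]; exact hexp1lt.le
  obtain ⟨D, hDval, hDinv⟩ : ∃ D : GL (Fin 3) (w.1.adicCompletion L), (D : Matrix (Fin 3) (Fin 3) (w.1.adicCompletion L)) = !![ϖ, 0, 0; 0, 1, 0; 0, 0, 1] ∧
      ((D⁻¹ : GL (Fin 3) (w.1.adicCompletion L)) : Matrix (Fin 3) (Fin 3) (w.1.adicCompletion L)) = !![ϖ⁻¹, 0, 0; 0, 1, 0; 0, 0, 1] :=
    ⟨⟨!![ϖ, 0, 0; 0, 1, 0; 0, 0, 1], !![ϖ⁻¹, 0, 0; 0, 1, 0; 0, 0, 1], by ext i j; fin_cases i <;> fin_cases j <;> simp [Matrix.mul_apply, Fin.sum_univ_three, hϖ0],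
      by ext i j; fin_cases i <;> fin_cases j <;> simp [Matrix.mul_apply, Fin.sum_univ_three, hϖ0]⟩, rfl, rfl⟩
  have hDdiag : (D : Matrix (Fin 3) (Fin 3) (w.1.adicCompletion L)) = Matrix.diagonal ![ϖ, 1, 1] := by rw [hDval]; ext i j; fin_cases i <;> fin_cases j <;> simp
  obtain ⟨g, hg⟩ : ∃ g : GL (Fin 3) (w.1.adicCompletion L), g = T⁻¹ * D := ⟨_, rfl⟩
  have hgE : ∀ y, g⁻¹ * E y * g = D⁻¹ * ψ y * D := fun y => by rw [hg, hψE]; group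
  have hvertex : IsVertexLattice (galAdicCompletionMap (L := L) (IsCMField.complexConj L) hw) ϖ (placeForm H' w.1) 2
      (latt (g : Matrix (Fin 3) (Fin 3) (w.1.adicCompletion L))) := by
    rw [hT, isVertexLattice_formCongr_iff, hg, mapGL_latt, mul_inv_cancel_left, hDdiag]
    simpa using isVertexLattice_two_latt_diagonal_zpow (K := w.1.adicCompletion L)
      (σ := galAdicCompletionMap (L := L) (IsCMField.complexConj L) hw) hd.σσ hd.σϖ hϖ1 hϖ0 1
  have hDn₁ : (((D⁻¹ * n₁ * D : GL (Fin 3) (w.1.adicCompletion L))) : Matrix (Fin 3) (Fin 3) (w.1.adicCompletion L)) = !![1, 0, δ; 0, 1, 0; 0, 0, 1] := by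
    rw [Units.val_mul, Units.val_mul, hDinv, hn₁, hDval]; ext i j; fin_cases i <;> fin_cases j <;> simp [Matrix.mul_apply, Fin.sum_univ_three, hϖ0]
  have hDn₁inv : ((((D⁻¹ * n₁ * D : GL (Fin 3) (w.1.adicCompletion L)))⁻¹ : GL (Fin 3) (w.1.adicCompletion L)) : Matrix (Fin 3) (Fin 3) (w.1.adicCompletion L)) =
      !![1, 0, -δ; 0, 1, 0; 0, 0, 1] := by
    rw [show (D⁻¹ * n₁ * D : GL (Fin 3) (w.1.adicCompletion L))⁻¹ = D⁻¹ * n₁⁻¹ * D by group, Units.val_mul, Units.val_mul, hDinv, hn₁inv, hDval]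
    ext i j; fin_cases i <;> fin_cases j <;> simp [Matrix.mul_apply, Fin.sum_univ_three, hϖ0]
  -- ## 0c. The Gram matrix `G_g = formCongr σ (T·g) J₀ = D J₀ D` of `latt g`, a basis `A♯ = g·G_g⁻¹` of the dual lattice `(latt g)^♯`, `E` through `ψ`
  have hEψ : ∀ y, E y = T⁻¹ * ψ y * T := fun y => by rw [hψE]; group
  have hHwdet : IsUnit (placeForm H' w.1).det := (Matrix.isUnit_iff_isUnit_det _).1 hH'w
  have hgdet : IsUnit ((g : GL (Fin 3) (w.1.adicCompletion L)) : Matrix (Fin 3) (Fin 3) (w.1.adicCompletion L)).det := Matrix.isUnits_det_units g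
  obtain ⟨Gg, hGgdef⟩ : ∃ Gg : Matrix (Fin 3) (Fin 3) (w.1.adicCompletion L),
      Gg = formCongr (galAdicCompletionMap (L := L) (IsCMField.complexConj L) hw) g (placeForm H' w.1) := ⟨_, rfl⟩
  have hGg : Gg = !![0, 0, ϖ; 0, 1, 0; ϖ, 0, 0] := by
    rw [hGgdef, hT, formCongr_formCongr, hg, mul_inv_cancel_left]
    have hDmap : (((D : GL (Fin 3) (w.1.adicCompletion L)) : Matrix (Fin 3) (Fin 3) (w.1.adicCompletion L)).map
        (galAdicCompletionMap (L := L) (IsCMField.complexConj L) hw))ᵀ = !![ϖ, 0, 0; 0, 1, 0; 0, 0, 1] := by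
      rw [hDval]; ext i j; fin_cases i <;> fin_cases j <;> simp [hd.σϖ]
    dsimp only [formCongr]
    rw [hDmap, hDval, antidiagonal_three_over_eq]
    ext i j; fin_cases i <;> fin_cases j <;> simp [Matrix.mul_apply, Fin.sum_univ_three]
  have hGgdet : IsUnit Gg.det := by
    rw [hGgdef]
    show IsUnit ((((g : GL (Fin 3) (w.1.adicCompletion L)) : Matrix (Fin 3) (Fin 3) (w.1.adicCompletion L)).map
        (galAdicCompletionMap (L := L) (IsCMField.complexConj L) hw))ᵀ * placeForm H' w.1 *
        ((g : GL (Fin 3) (w.1.adicCompletion L)) : Matrix (Fin 3) (Fin 3) (w.1.adicCompletion L))).det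
    rw [Matrix.det_mul, Matrix.det_mul]
    exact ((isUnit_det_transpose_map _ hgdet).mul hHwdet).mul hgdet
  obtain ⟨Ad, hAd⟩ : ∃ Ad : Matrix (Fin 3) (Fin 3) (w.1.adicCompletion L), Ad = ((g : GL (Fin 3) (w.1.adicCompletion L)) : Matrix (Fin 3) (Fin 3) (w.1.adicCompletion L)) * Gg⁻¹ :=
    ⟨_, rfl⟩
  have hdual : dualLatt (galAdicCompletionMap (L := L) (IsCMField.complexConj L) hw) (placeForm H' w.1) (latt (g : Matrix (Fin 3) (Fin 3) (w.1.adicCompletion L))) = latt Ad := by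
    rw [hAd, hGgdef]; exact dualLatt_latt _ hd.vσ hHwdet g
  -- ## 1. The level predicates through `ψ`, the type-two vertex predicates, the rank of a class and the pieces
  obtain ⟨lev, hlev⟩ : ∃ lev : ℤ → (cmDatum L 3 H').Local v → Prop, ∀ m y, lev m y ↔
      ∀ a b, Valued.v ((((ψ y : GL (Fin 3) (w.1.adicCompletion L)) : Matrix (Fin 3) (Fin 3) (w.1.adicCompletion L)) - 1) a b) ≤ WithZero.exp m := ⟨_, fun _ _ => Iff.rfl⟩
  obtain ⟨sq1, hsq1⟩ : ∃ sq1 : (cmDatum L 3 H').Local v → Prop, ∀ y, sq1 y ↔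
      ∀ a b, Valued.v (((((ψ y : GL (Fin 3) (w.1.adicCompletion L)) : Matrix (Fin 3) (Fin 3) (w.1.adicCompletion L)) - 1) *
        (((ψ y : GL (Fin 3) (w.1.adicCompletion L)) : Matrix (Fin 3) (Fin 3) (w.1.adicCompletion L)) - 1)) a b) ≤ WithZero.exp (-1 : ℤ) := ⟨_, fun _ => Iff.rfl⟩
  obtain ⟨levD, hlevD⟩ : ∃ levD : (cmDatum L 3 H').Local v → Prop, ∀ y, levD y ↔
      IsIntMatrix ((((g : GL (Fin 3) (w.1.adicCompletion L)) : Matrix (Fin 3) (Fin 3) (w.1.adicCompletion L)))⁻¹ *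
        ((((E y : GL (Fin 3) (w.1.adicCompletion L)) : Matrix (Fin 3) (Fin 3) (w.1.adicCompletion L)) - 1) * Ad)) := ⟨_, fun _ => Iff.rfl⟩
  obtain ⟨stab, hstab⟩ : ∃ stab : (cmDatum L 3 H').Local v → Prop, ∀ y, stab y ↔
      mapGL (E y) (latt (g : Matrix (Fin 3) (Fin 3) (w.1.adicCompletion L))) = latt (g : Matrix (Fin 3) (Fin 3) (w.1.adicCompletion L)) := ⟨_, fun _ => Iff.rfl⟩
  obtain ⟨b, hb⟩ : ∃ b : ConjClasses ((cmDatum L 3 H').Local v) → ℕ, ∀ c, b c =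
      if ψ (Quotient.out c) = 1 then 0 else if IsCj (ψ (Quotient.out c)) n₁ then 1 else if IsCj (ψ (Quotient.out c)) n₀ then 2 else 3 := ⟨_, fun _ => rfl⟩
  obtain ⟨P, hP⟩ : ∃ P : ConjClasses ((cmDatum L 3 H').Local v) → Set ((cmDatum L 3 H').Local v), ∀ c, P c =
      if b c = 0 then {y | y ∈ cmLocalIntegralLevel L 3 H' v ∧ lev (-1) y}
      else if b c = 1 then {y | stab y ∧ ¬ levD y}
      else if b c = 2 then {y | y ∈ cmLocalIntegralLevel L 3 H' v ∧ ¬ lev (-1) y}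
      else {y | y ∈ cmLocalIntegralLevel L 3 H' v ∧ ¬ sq1 y} := ⟨_, fun _ => rfl⟩
  -- ## 2. Topology of the level sets and of the type-two vertex piece
  obtain ⟨hKc, hKo⟩ := isCompact_isOpen_cmLocalIntegralLevel L 3 H' v
  have hKcl : IsClosed (cmLocalIntegralLevel L 3 H' v : Set ((cmDatum L 3 H').Local v)) := (cmLocalIntegralLevel L 3 H' v).isClosed_of_isOpen hKo
  have hball : ∀ m : ℤ, IsClopen {x : w.1.adicCompletion L | Valued.v x ≤ WithZero.exp m} := fun m => isClopen_setOf_valued_le L w.1 WithZero.exp_ne_zero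
  have hψcontM : Continuous fun y => ((ψ y : GL (Fin 3) (w.1.adicCompletion L)) : Matrix (Fin 3) (Fin 3) (w.1.adicCompletion L)) := continuous_pi fun a => continuous_pi fun c => hψcont a c
  have hEcontM : Continuous fun y => ((E y : GL (Fin 3) (w.1.adicCompletion L)) : Matrix (Fin 3) (Fin 3) (w.1.adicCompletion L)) := by
    have hfun : (fun y => ((E y : GL (Fin 3) (w.1.adicCompletion L)) : Matrix (Fin 3) (Fin 3) (w.1.adicCompletion L))) =
        fun y => ((T⁻¹ : GL (Fin 3) (w.1.adicCompletion L)) : Matrix (Fin 3) (Fin 3) (w.1.adicCompletion L)) *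
          ((ψ y : GL (Fin 3) (w.1.adicCompletion L)) : Matrix (Fin 3) (Fin 3) (w.1.adicCompletion L)) * (T : Matrix (Fin 3) (Fin 3) (w.1.adicCompletion L)) := by
      funext y; rw [hEψ, Units.val_mul, Units.val_mul]
    rw [hfun]; exact (continuous_const.mul hψcontM).mul continuous_const
  have hlev_clopen : ∀ m, IsClopen {y | lev m y} := by
    intro m
    have hset : {y | lev m y} = ⋂ a : Fin 3, ⋂ c : Fin 3,
        (fun y => ((((ψ y : GL (Fin 3) (w.1.adicCompletion L)) : Matrix (Fin 3) (Fin 3) (w.1.adicCompletion L)) - 1) a c)) ⁻¹'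
          {x : w.1.adicCompletion L | Valued.v x ≤ WithZero.exp m} := by
      ext y; simp only [Set.mem_setOf_eq, hlev, Set.mem_iInter, Set.mem_preimage]
    rw [hset]; exact isClopen_iInter_of_finite fun a => isClopen_iInter_of_finite fun c => (hball m).preimage ((hψcontM.sub continuous_const).matrix_elem a c)
  have hsq1_clopen : IsClopen {y | sq1 y} := by
    have hset : {y | sq1 y} = ⋂ a : Fin 3, ⋂ c : Fin 3,
        (fun y => (((((ψ y : GL (Fin 3) (w.1.adicCompletion L)) : Matrix (Fin 3) (Fin 3) (w.1.adicCompletion L)) - 1) *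
          (((ψ y : GL (Fin 3) (w.1.adicCompletion L)) : Matrix (Fin 3) (Fin 3) (w.1.adicCompletion L)) - 1)) a c)) ⁻¹'
          {x : w.1.adicCompletion L | Valued.v x ≤ WithZero.exp (-1 : ℤ)} := by
      ext y; simp only [Set.mem_setOf_eq, hsq1, Set.mem_iInter, Set.mem_preimage]
    rw [hset]; exact isClopen_iInter_of_finite fun a => isClopen_iInter_of_finite fun c =>
      (hball (-1)).preimage (((hψcontM.sub continuous_const).mul (hψcontM.sub continuous_const)).matrix_elem a c)
  obtain ⟨Kg, hKgc, hKgo, hKg⟩ := exists_vertexStabilizer L v w hw H' g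
  have hstabKg : {y | stab y} = (Kg : Set ((cmDatum L 3 H').Local v)) := Set.ext fun y => by rw [Set.mem_setOf_eq, hstab, SetLike.mem_coe, hKg, hE]
  have hXcontM : Continuous fun y => (((g : GL (Fin 3) (w.1.adicCompletion L)) : Matrix (Fin 3) (Fin 3) (w.1.adicCompletion L)))⁻¹ *
      ((((E y : GL (Fin 3) (w.1.adicCompletion L)) : Matrix (Fin 3) (Fin 3) (w.1.adicCompletion L)) - 1) * Ad) :=
    continuous_const.mul ((hEcontM.sub continuous_const).mul continuous_const)
  have hball0 : IsClopen {x : w.1.adicCompletion L | Valued.v x ≤ 1} := by simpa only [WithZero.exp_zero] using hball 0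
  have hlevD_clopen : IsClopen {y | levD y} := by
    have hset : {y | levD y} = ⋂ a : Fin 3, ⋂ c : Fin 3,
        (fun y => ((((g : GL (Fin 3) (w.1.adicCompletion L)) : Matrix (Fin 3) (Fin 3) (w.1.adicCompletion L)))⁻¹ *
          ((((E y : GL (Fin 3) (w.1.adicCompletion L)) : Matrix (Fin 3) (Fin 3) (w.1.adicCompletion L)) - 1) * Ad)) a c) ⁻¹'
          {x : w.1.adicCompletion L | Valued.v x ≤ 1} := by
      ext y; simp only [Set.mem_setOf_eq, hlevD, IsIntMatrix, Set.mem_iInter, Set.mem_preimage]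
    rw [hset]; exact isClopen_iInter_of_finite fun a => isClopen_iInter_of_finite fun c => hball0.preimage (hXcontM.matrix_elem a c)
  have hKclopen : IsClopen (cmLocalIntegralLevel L 3 H' v : Set ((cmDatum L 3 H').Local v)) := ⟨hKcl, hKo⟩
  have hKgclopen : IsClopen (Kg : Set ((cmDatum L 3 H').Local v)) := ⟨Kg.isClosed_of_isOpen hKgo, hKgo⟩
  have hXeq : {y | stab y ∧ ¬ levD y} = (Kg : Set ((cmDatum L 3 H').Local v)) ∩ {y | ¬ levD y} := by rw [← hstabKg]; rfl
  have hPclopen : ∀ c, IsClopen (P c) := fun c => by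
    rw [hP c]; split_ifs
    · exact hKclopen.inter (hlev_clopen (-1))
    · rw [hXeq]; exact hKgclopen.inter hlevD_clopen.compl
    · exact hKclopen.inter (hlev_clopen (-1)).compl
    · exact hKclopen.inter hsq1_clopen.compl
  have hPo : ∀ c ∈ S, IsOpen (P c) := fun c _ => (hPclopen c).isOpen
  have hPcl : ∀ c ∈ S, IsClosed (P c) := fun c _ => (hPclopen c).isClosed
  have hPc : ∀ c ∈ S, IsCompact (P c) := fun c _ => by
    by_cases h1 : b c = 1
    · refine hKgc.of_isClosed_subset (hPclopen c).isClosed fun y hy => ?_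
      rw [hP c, if_neg (by omega), if_pos h1, hXeq] at hy; exact hy.1
    · refine hKc.of_isClosed_subset (hPclopen c).isClosed fun y hy => ?_
      rw [hP c] at hy; split_ifs at hy <;> exact hy.1
  -- ## 3. The rank: the four values and the classification (★ FILE 1)
  have hb_le : ∀ c, b c ≤ 3 := fun c => by rw [hb c]; split_ifs <;> omega
  have hb0 : ∀ c, b c = 0 ↔ ψ (Quotient.out c) = 1 := fun c => by
    rw [hb c]; split_ifs with h0 <;> first | exact iff_of_true rfl h0 | exact iff_of_false (by decide) h0
  have hb1 : ∀ c, b c = 1 ↔ ¬ ψ (Quotient.out c) = 1 ∧ IsCj (ψ (Quotient.out c)) n₁ := fun c => by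
    rw [hb c]; split_ifs with h0 h1 h2
    · exact iff_of_false (by decide) fun h => h.1 h0
    · exact iff_of_true rfl ⟨h0, h1⟩
    · exact iff_of_false (by decide) fun h => h1 h.2
    · exact iff_of_false (by decide) fun h => h1 h.2
  have hb2 : ∀ c, b c = 2 ↔ ¬ ψ (Quotient.out c) = 1 ∧ ¬ IsCj (ψ (Quotient.out c)) n₁ ∧ IsCj (ψ (Quotient.out c)) n₀ := fun c => by
    rw [hb c]; split_ifs with h0 h1 h2
    · exact iff_of_false (by decide) fun h => h.1 h0
    · exact iff_of_false (by decide) fun h => h.2.1 h1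
    · exact iff_of_true rfl ⟨h0, h1, h2⟩
    · exact iff_of_false (by decide) fun h => h2 h.2.2
  have hreg3 : ∀ u ∈ S, b u = 3 →
      (((ψ (Quotient.out u) : GL (Fin 3) (w.1.adicCompletion L)) : Matrix (Fin 3) (Fin 3) (w.1.adicCompletion L)) - 1) *
        (((ψ (Quotient.out u) : GL (Fin 3) (w.1.adicCompletion L)) : Matrix (Fin 3) (Fin 3) (w.1.adicCompletion L)) - 1) ≠ 0 := by
    intro u _ h3 hsq
    have hbu := hb u
    split_ifs at hbu with h0 h1 h2 <;> try omega
    rcases sq_zero_unipotent_cases (galAdicCompletionMap (L := L) (IsCMField.complexConj L) hw) hd hnormU hσδ hvδ hn₀ hn₁ (hψU _) hsq with h | h | h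
    · exact h0 h
    · exact h1 ((hIsCj _ _).2 h)
    · exact h2 ((hIsCj _ _).2 h)
  -- ## 4. The table: diagonal representatives and above-diagonal zeros
  have hlev_one : ∀ y m, ψ y = 1 → lev m y := fun y m hy => by
    rw [hlev]; intro a c; rw [hy, Units.val_one, sub_self, Matrix.zero_apply, map_zero]; exact zero_le
  have hE1 : ∀ y, ψ y = 1 → E y = 1 := fun y hy => by rw [hEψ, hy, mul_one, inv_mul_cancel]
  have hlevD_one : ∀ y, ψ y = 1 → levD y := fun y hy => by
    rw [hlevD]; intro a c; rw [hE1 y hy, Units.val_one, sub_self, Matrix.zero_mul, Matrix.mul_zero, Matrix.zero_apply, map_zero]; exact zero_le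
  have hPx : ∀ u ∈ S, ∃ x ∈ P u, ConjClasses.mk x = u := by
    intro u hu; have hcases : b u = 0 ∨ b u = 1 ∨ b u = 2 ∨ b u = 3 := by have := hb_le u; omega
    rcases hcases with h0 | h1 | h2 | h3
    · -- the class of `1`: `x = out u` itself lies in `K(2)`
      have hψ1 := (hb0 u).1 h0; refine ⟨Quotient.out u, ?_, hout u⟩
      rw [hP u, if_pos h0]
      exact ⟨(hψK _).2 (by rw [hψ1, Units.val_one]; exact isIntMatrix_one), hlev_one _ _ hψ1⟩
    · -- `tv⁻`: `x = ψ⁻¹ n(ϖδ)` lies in `K_g ∖ K_g(1)`: `g⁻¹·e(x)·g = D⁻¹ n(ϖδ) D = n(δ)` is integral (both ways) with the UNIT corner `δ`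
      obtain ⟨k, hk, hkn⟩ := (hIsCj _ _).1 ((hb1 u).1 h1).2
      obtain ⟨x, hx⟩ := hψsurj n₁ hn₁U
      have hgx : g⁻¹ * E x * g = D⁻¹ * n₁ * D := by rw [hgE, hx]
      refine ⟨x, ?_, ?_⟩
      · rw [hP u, if_neg (by omega), if_pos h1]
        refine ⟨(hstab x).2 ((mapGL_latt_eq_latt_iff (E x) g).2 ⟨?_, ?_⟩), fun h => ?_⟩
        · rw [hgx]; exact isIntMatrix_cornerUnipotent hvδ.le hDn₁
        · rw [show g⁻¹ * (E x)⁻¹ * g = (g⁻¹ * E x * g)⁻¹ by group, hgx]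
          exact isIntMatrix_cornerUnipotent (by rw [Valuation.map_neg]; exact hvδ.le) hDn₁inv
        · -- `n(ϖδ) ∉ K_g⁺`: `X := g⁻¹(E x − 1)·A♯ = (D⁻¹n(ϖδ)D − 1)·G_g⁻¹` integral ⇒ `(X·G_g)₀₂ = X₀₀·ϖ = (n(δ) − 1)₀₂ = δ`, contradicting `|δ| = 1`
          have hX := (hlevD x).1 h
          set X := (((g : GL (Fin 3) (w.1.adicCompletion L)) : Matrix (Fin 3) (Fin 3) (w.1.adicCompletion L)))⁻¹ *
            ((((E x : GL (Fin 3) (w.1.adicCompletion L)) : Matrix (Fin 3) (Fin 3) (w.1.adicCompletion L)) - 1) * Ad) with hXdef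
          have hXG : X * Gg =
              (((D⁻¹ * n₁ * D : GL (Fin 3) (w.1.adicCompletion L))) : Matrix (Fin 3) (Fin 3) (w.1.adicCompletion L)) - 1 := by
            have h1 : (((D⁻¹ * n₁ * D : GL (Fin 3) (w.1.adicCompletion L))) : Matrix (Fin 3) (Fin 3) (w.1.adicCompletion L)) - 1 =
                (((g : GL (Fin 3) (w.1.adicCompletion L)) : Matrix (Fin 3) (Fin 3) (w.1.adicCompletion L)))⁻¹ *
                  (((E x : GL (Fin 3) (w.1.adicCompletion L)) : Matrix (Fin 3) (Fin 3) (w.1.adicCompletion L)) - 1) *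
                  ((g : GL (Fin 3) (w.1.adicCompletion L)) : Matrix (Fin 3) (Fin 3) (w.1.adicCompletion L)) := by
              rw [← hgx, Units.val_mul, Units.val_mul, Matrix.coe_units_inv, Matrix.mul_sub, Matrix.sub_mul, Matrix.mul_one,
                Matrix.nonsing_inv_mul _ hgdet]
            rw [h1, hXdef, hAd]
            simp only [Matrix.mul_assoc]
            rw [Matrix.nonsing_inv_mul _ hGgdet, Matrix.mul_one]
          have h02 : X 0 0 * ϖ = δ := by
            have h' := congrArg (fun M : Matrix (Fin 3) (Fin 3) (w.1.adicCompletion L) => M 0 2) hXG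
            simpa [hGg, hDn₁, Matrix.mul_apply, Fin.sum_univ_three, Matrix.sub_apply] using h'
          have hv := congrArg Valued.v h02
          rw [map_mul, hd.vϖ, hvδ] at hv
          have hle : Valued.v (X 0 0) * WithZero.exp (-1 : ℤ) ≤ WithZero.exp (-1 : ℤ) :=
            calc Valued.v (X 0 0) * WithZero.exp (-1 : ℤ) ≤ 1 * WithZero.exp (-1 : ℤ) := mul_le_mul' (hX 0 0) le_rfl
              _ = WithZero.exp (-1 : ℤ) := one_mul _
          rw [hv] at hle
          exact absurd hle (not_le.2 hexp1lt)
      · rw [← hout u, hψconj]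
        exact ⟨k⁻¹, inv_mem hk, by rw [hx, ← hkn]; group⟩
    · -- `tv⁺`: `x = ψ⁻¹ n(δ) ∈ K ∖ K(1)`
      obtain ⟨k, hk, hkn⟩ := (hIsCj _ _).1 ((hb2 u).1 h2).2.2
      obtain ⟨x, hx⟩ := hψsurj n₀ hn₀U
      refine ⟨x, ?_, ?_⟩
      · rw [hP u, if_neg (by omega), if_neg (by omega), if_pos h2]
        refine ⟨(hψK x).2 (by rw [hx]; exact isIntMatrix_cornerUnipotent hvδ.le hn₀), fun h => ?_⟩
        have h' := (forall_v_cornerUnipotent_sub_one_apply_le_iff hn₀ _).1 (by rw [← hx]; exact (hlev _ _).1 h)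
        rw [hvδ, ← WithZero.exp_zero, WithZero.exp_le_exp] at h'
        omega
      · rw [← hout u, hψconj]
        exact ⟨k⁻¹, inv_mem hk, by rw [hx, ← hkn]; group⟩
    · -- `reg`: `x = ψ⁻¹ u(1, −t₀) ∈ R` (ONE regular class, ★ `exists_conj_eq_of_regular_unipotent`)
      obtain ⟨k, hk, hkr⟩ := exists_conj_eq_of_regular_unipotent (galAdicCompletionMap (L := L) (IsCMField.complexConj L) hw) hd.σσ h2K (hψU _) hurU
        ⟨3, hψnil u hu⟩ hurnil (hreg3 u hu h3) hurreg
      obtain ⟨x, hx⟩ := hψsurj ur hurU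
      refine ⟨x, ?_, ?_⟩
      · rw [hP u, if_neg (by omega), if_neg (by omega), if_neg (by omega)]
        exact ⟨(hψK x).2 (by rw [hx]; exact hurint), fun h => not_forall_v_upperUnipotentOne_sub_one_sq_apply_le hur hexp1lt (by rw [← hx]; exact (hsq1 x).1 h)⟩
      · rw [← hout u, hψconj]
        exact ⟨k⁻¹, inv_mem hk, by rw [hx, ← hkr]; group⟩
  have hbinj : Set.InjOn b ↑S := by
    intro c hc c' hc' hcc'
    rw [Finset.mem_coe] at hc hc'
    suffices hk : IsCj (ψ (Quotient.out c)) (ψ (Quotient.out c')) by rw [← hout c, ← hout c']; exact (hψconj _ _).2 ((hIsCj _ _).1 hk)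
    rw [hIsCj]
    have hcases : b c = 0 ∨ b c = 1 ∨ b c = 2 ∨ b c = 3 := by have := hb_le c; omega
    rcases hcases with h0 | h1 | h2 | h3
    · refine ⟨1, one_mem _, ?_⟩
      rw [(hb0 c).1 h0, (hb0 c').1 (by omega), mul_one, one_mul, inv_one]
    · obtain ⟨k, hk, hkn⟩ := (hIsCj _ _).1 ((hb1 c).1 h1).2
      obtain ⟨k', hk', hkn'⟩ := (hIsCj _ _).1 ((hb1 c').1 (by omega)).2
      refine ⟨k'⁻¹ * k, mul_mem (inv_mem hk') hk, ?_⟩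
      rw [show k'⁻¹ * k * ψ (Quotient.out c) * (k'⁻¹ * k)⁻¹ = k'⁻¹ * (k * ψ (Quotient.out c) * k⁻¹) * k' by group, hkn, ← hkn']; group
    · obtain ⟨k, hk, hkn⟩ := (hIsCj _ _).1 ((hb2 c).1 h2).2.2
      obtain ⟨k', hk', hkn'⟩ := (hIsCj _ _).1 ((hb2 c').1 (by omega)).2.2
      refine ⟨k'⁻¹ * k, mul_mem (inv_mem hk') hk, ?_⟩
      rw [show k'⁻¹ * k * ψ (Quotient.out c) * (k'⁻¹ * k)⁻¹ = k'⁻¹ * (k * ψ (Quotient.out c) * k⁻¹) * k' by group, hkn, ← hkn']; group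
    · exact exists_conj_eq_of_regular_unipotent (galAdicCompletionMap (L := L) (IsCMField.complexConj L) hw) hd.σσ h2K (hψU _) (hψU _)
        ⟨3, hψnil c hc⟩ ⟨3, hψnil c' hc'⟩ (hreg3 c hc h3) (hreg3 c' hc' (by omega))
  have hsep : ∀ u ∈ S, ∀ u' ∈ S, b u < b u' → ∀ y ∈ P u', ConjClasses.mk y ≠ u := by
    intro u hu u' _ hlt y hy hyu
    obtain ⟨k, hk, hky⟩ := (hψconj (Quotient.out u) y).1 (by rw [hout u, hyu])
    have hy1 : b u = 0 → ψ y = 1 := fun h0 => by rw [← hky, (hb0 u).1 h0, mul_one, mul_inv_cancel]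
    have hyn₁ : b u = 1 → ∃ k₁ : GL (Fin 3) (w.1.adicCompletion L), k₁ ∈ unitaryGroupOfForm (galAdicCompletionMap (L := L) (IsCMField.complexConj L) hw) ((StdForm.antidiagonal 3).over (w.1.adicCompletion L)) ∧
        ψ y = k₁ * n₁ * k₁⁻¹ := fun h1 => by
      obtain ⟨k₁, hk₁, hk₁n⟩ := (hIsCj _ _).1 ((hb1 u).1 h1).2
      exact ⟨k * k₁⁻¹, mul_mem hk (inv_mem hk₁), by rw [← hky, ← hk₁n]; group⟩
    have hyn₀ : b u = 2 → ∃ k₀ : GL (Fin 3) (w.1.adicCompletion L), ψ y = k₀ * n₀ * k₀⁻¹ := fun h2 => by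
      obtain ⟨k₀, -, hk₀n⟩ := (hIsCj _ _).1 ((hb2 u).1 h2).2.2
      exact ⟨k * k₀⁻¹, by rw [← hky, ← hk₀n]; group⟩
    rw [hP u'] at hy
    have hcases : b u' = 1 ∨ b u' = 2 ∨ b u' = 3 := by have := hb_le u'; omega
    rcases hcases with h1 | h2 | h3
    · -- `P u' = K_g ∖ K_g(1)` misses the class of `1` (`ψ y = 1 ⇒ g⁻¹·e(y)·g = 1`)
      rw [if_neg (by omega), if_pos h1, Set.mem_setOf_eq] at hy
      exact hy.2 (hlevD_one y (hy1 (by omega)))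
    · -- `P u' = K ∖ K(1)` misses the class of `1` and — THE PARITY ROW — the class of `n(ϖδ)`
      rw [if_neg (by omega), if_neg (by omega), if_pos h2, Set.mem_setOf_eq] at hy
      apply hy.2
      have hbu : b u = 0 ∨ b u = 1 := by omega
      rcases hbu with h0 | h1
      · exact hlev_one y _ (hy1 h0)
      · obtain ⟨k₁, hk₁, hψy⟩ := hyn₁ h1
        have hint := (hψK y).1 hy.1
        rw [hlev, hψy]; rw [hψy] at hint
        exact forall_v_conj_cornerUnipotent_sub_one_apply_le_exp_neg_one (galAdicCompletionMap (L := L) (IsCMField.complexConj L) hw) hd.vσ hv1 hn₁ hk₁ hint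
    · -- `P u' = R` misses the classes of `1`, `n(ϖδ)`, `n(δ)` (all square-zero)
      rw [if_neg (by omega), if_neg (by omega), if_neg (by omega), Set.mem_setOf_eq] at hy
      apply hy.2
      have hsq0 : (((ψ y : GL (Fin 3) (w.1.adicCompletion L)) : Matrix (Fin 3) (Fin 3) (w.1.adicCompletion L)) - 1) *
          (((ψ y : GL (Fin 3) (w.1.adicCompletion L)) : Matrix (Fin 3) (Fin 3) (w.1.adicCompletion L)) - 1) = 0 := by
        have hbu : b u = 0 ∨ b u = 1 ∨ b u = 2 := by omega
        rcases hbu with h0 | h1 | h2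
        · rw [hy1 h0, Units.val_one, sub_self, Matrix.zero_mul]
        · obtain ⟨k₁, -, hψy⟩ := hyn₁ h1
          rw [hψy]; exact conj_cornerUnipotent_sub_one_mul_self hn₁ _
        · obtain ⟨k₀, hψy⟩ := hyn₀ h2
          rw [hψy]; exact conj_cornerUnipotent_sub_one_mul_self hn₀ _
      rw [hsq1]; intro a c; rw [hsq0, Matrix.zero_apply, map_zero]; exact zero_le
  -- ## 5. Assembly: the frame-free reading of the four pieces (`ψ = T·e·T⁻¹`, `T ∈ GL₃(𝒪_w)`; `g⁻¹·e·g = D⁻¹·ψ·D`)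
  obtain ⟨hTi, hTii⟩ := isIntMatrix_frame L v w hTint
  have hlevE : ∀ y, lev (-1) y ↔ ∀ a b, Valued.v ((((E y : GL (Fin 3) (w.1.adicCompletion L)) : Matrix (Fin 3) (Fin 3) (w.1.adicCompletion L)) - 1) a b) ≤
      WithZero.exp (-1 : ℤ) := fun y => by
    rw [hlev, hψE]; exact forall_v_conj_sub_one_apply_le_iff hTi hTii (E y) _
  have hsq1E : ∀ y, sq1 y ↔ ∀ a b, Valued.v (((((E y : GL (Fin 3) (w.1.adicCompletion L)) : Matrix (Fin 3) (Fin 3) (w.1.adicCompletion L)) - 1) *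
      (((E y : GL (Fin 3) (w.1.adicCompletion L)) : Matrix (Fin 3) (Fin 3) (w.1.adicCompletion L)) - 1)) a b) ≤ WithZero.exp (-1 : ℤ) := fun y => by
    rw [hsq1, hψE]; exact forall_v_conj_sub_one_sq_apply_le_iff hTi hTii (E y) _
  have hlevDE : ∀ y, levD y ↔ (dualLatt (galAdicCompletionMap (L := L) (IsCMField.complexConj L) hw) (placeForm H' w.1)
      (latt (g : Matrix (Fin 3) (Fin 3) (w.1.adicCompletion L)))).map ((Matrix.toLin'
      (((E y : GL (Fin 3) (w.1.adicCompletion L)) : Matrix (Fin 3) (Fin 3) (w.1.adicCompletion L)) - 1)).restrictScalars (Valued.integer (w.1.adicCompletion L))) ≤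
        latt (g : Matrix (Fin 3) (Fin 3) (w.1.adicCompletion L)) := fun y => by
    rw [hlevD, hdual, ← latt_mul, latt_le_latt_iff hgdet]
  refine ⟨ϖ, g, hd.vϖ, hvertex, fun u => (P u).indicator fun _ => (1 : ℂ), fun i => isLocSmooth_indicator (hPo i i.2) (hPcl i i.2) (hPc i i.2), fun i => ?_,
    det_classOrbitalIntegral_indicator_ne_zero S mU hmU hRao P hPo hPc hPcl hPx b hbinj hsep⟩
  simp only [← hE]
  have hcases : b i = 0 ∨ b i = 1 ∨ b i = 2 ∨ b i = 3 := by have := hb_le i; omega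
  rw [hP i]
  rcases hcases with h0 | h1 | h2 | h3
  · refine Or.inl ?_; rw [if_pos h0]; congr 1; ext y; simp only [Set.mem_setOf_eq, hlevE]
  · refine Or.inr (Or.inl ?_); rw [if_neg (by omega), if_pos h1]; congr 1
    exact Set.ext fun y => ⟨fun h => ⟨(hstab y).1 h.1, fun h' => h.2 ((hlevDE y).2 h')⟩, fun h => ⟨(hstab y).2 h.1, fun h' => h.2 ((hlevDE y).1 h')⟩⟩
  · refine Or.inr (Or.inr (Or.inl ?_)); rw [if_neg (by omega), if_neg (by omega), if_pos h2]; congr 1; ext y; simp only [Set.mem_setOf_eq, hlevE]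
  · refine Or.inr (Or.inr (Or.inr ?_)); rw [if_neg (by omega), if_neg (by omega), if_neg (by omega)]; congr 1; ext y; simp only [Set.mem_setOf_eq, hsq1E]

end Literature.NumberTheory.Rogawski1990
end

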